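import Summits.KontsevichZagierPeriods.KontsevichZagierPeriods.Theorems.MzvKernelInKZ.Negative.Core

/-!
# `MzvKernelInKZ` (stmt-KontsevichZagierPeriods-3914): negative side — duality is one change-of-variables move

Companion of `Negative/Core.lean`.  **Duality is ONE change-of-variables move**: for every word
`ε` the canonical representations `[Δ_w, q ω_ε]` and `[Δ_w, q ω_{ε†}]`, `ε†ᵢ = ¬ ε_{w−1−i}`, differ
by one instance of Kontsevich–Zagier's rule (2) along the affine involution
`Φ(t)ᵢ = 1 − t_{w−1−i}` of the simplex (`|det Φ'| = 1` because `Φ'² = id`; polynomial, hence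
`ℚ`-semialgebraic).  So the duality relations `ζ(s) = ζ(s†)` (Zagier 1994, §9) are inside the
calculus with no further input (`duality_mem_changeOfVariablesRel`, `duality_mem_relations`).

Sources: M. Kontsevich, D. Zagier, *Periods* (2001), §1.2 rule (2); D. Zagier (1994), §9. -/

noncomputable section

namespace Summit.KontsevichZagierPeriods.MzvKernelInKZ.Negative

open Set MeasureTheory MvPolynomial
open Literature.NumberTheory.Transcendental
open Summit.KontsevichZagierPeriods.KontsevichZagierPeriods.Theses.LinRedNormalForm (MzvKernelInKZ)

section Duality

variable {w : ℕ}

/-- The dual word `ε†ᵢ = ¬ ε (rev i)`. [folklore] -/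
def dualWord (ε : Fin w → Bool) : Fin w → Bool := fun i => !(ε (Fin.rev i))

/-- The dual of an admissible word is admissible. [folklore] -/
theorem adm_dualWord {ε : Fin w → Bool} (hε : Adm ε) : Adm (dualWord ε) := by
  intro h
  obtain ⟨h0, h1⟩ := hε h
  have e0 : Fin.rev (⟨0, h⟩ : Fin w) = ⟨w - 1, Nat.sub_one_lt_of_lt h⟩ := Fin.ext (by simp)
  have e1 : Fin.rev (⟨w - 1, Nat.sub_one_lt_of_lt h⟩ : Fin w) = ⟨0, h⟩ := Fin.ext (by simp; omega)
  simp [dualWord, e0, e1, h0, h1]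

/-- The duality involution of the simplex. [folklore] -/
def dualMap (w : ℕ) (x : Fin w → ℝ) : Fin w → ℝ := fun i => 1 - x (Fin.rev i)

/-- Its (constant) derivative `v ↦ (i ↦ −v (rev i))`. [folklore] -/
def dualLin (w : ℕ) : (Fin w → ℝ) →L[ℝ] (Fin w → ℝ) :=
  -(LinearMap.toContinuousLinearMap (LinearMap.funLeft ℝ ℝ (Fin.rev : Fin w → Fin w)))

/-- `dualLin w v i = − v (rev i)`. [folklore] -/
@[simp] theorem dualLin_apply (v : Fin w → ℝ) (i : Fin w) : dualLin w v i = -v (Fin.rev i) := by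
  simp [dualLin, LinearMap.funLeft_apply]

/-- `dualMap w x i = 1 − x (rev i)`. [folklore] -/
@[simp] theorem dualMap_apply (x : Fin w → ℝ) (i : Fin w) : dualMap w x i = 1 - x (Fin.rev i) := rfl

/-- The duality map is an involution. [folklore] -/
theorem dualMap_dualMap (x : Fin w → ℝ) : dualMap w (dualMap w x) = x := by
  funext i; simp

/-- The duality map is affine: `Φ = Φ' + (1, …, 1)`. [folklore] -/
theorem dualMap_eq_add (x : Fin w → ℝ) : dualMap w x = dualLin w x + fun _ => (1 : ℝ) := by
  funext i; simp; ring

/-- The duality map has derivative `dualLin` everywhere. [folklore] -/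
theorem hasFDerivAt_dualMap (x : Fin w → ℝ) : HasFDerivAt (dualMap w) (dualLin w) x := by
  have : dualMap w = fun x => dualLin w x + fun _ => (1 : ℝ) := funext (dualMap_eq_add)
  rw [this]
  exact (dualLin w).hasFDerivAt.add_const _

/-- `Φ'² = id`, hence `|det Φ'| = 1` (no permutation sign needs computing). [folklore] -/
theorem abs_det_dualLin : |(dualLin w).det| = 1 := by
  have hcomp : (dualLin w : (Fin w → ℝ) →ₗ[ℝ] (Fin w → ℝ)).comp
      (dualLin w : (Fin w → ℝ) →ₗ[ℝ] (Fin w → ℝ)) = LinearMap.id := by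
    apply LinearMap.ext
    intro v
    funext i
    simp
  have h := congrArg LinearMap.det hcomp
  rw [LinearMap.det_comp, LinearMap.det_id] at h
  change |LinearMap.det (dualLin w : (Fin w → ℝ) →ₗ[ℝ] (Fin w → ℝ))| = 1
  rcases mul_self_eq_one_iff.mp h with h1 | h1 <;> simp [h1]

/-- The duality involution preserves the simplex. [folklore] -/
theorem dualMap_mem_simplex {x : Fin w → ℝ} (hx : x ∈ simplex w) : dualMap w x ∈ simplex w := by
  obtain ⟨h0, h1, ha⟩ := hx
  refine ⟨fun i => ?_, fun i => ?_, fun i j hij => ?_⟩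
  · simp only [dualMap_apply]; linarith [h1 (Fin.rev i)]
  · simp only [dualMap_apply]; linarith [h0 (Fin.rev i)]
  · simp only [dualMap_apply]
    have : Fin.rev j < Fin.rev i := Fin.rev_lt_rev.mpr hij
    linarith [ha this]

/-- The duality involution maps the simplex onto itself. [folklore] -/
theorem image_dualMap_simplex : dualMap w '' simplex w = simplex w := by
  apply Subset.antisymm
  · rintro _ ⟨x, hx, rfl⟩
    exact dualMap_mem_simplex hx
  · intro x hx
    exact ⟨dualMap w x, dualMap_mem_simplex hx, dualMap_dualMap x⟩

/-- The duality involution is injective on the simplex. [folklore] -/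
theorem injOn_dualMap : InjOn (dualMap w) (simplex w) := by
  intro x _ y _ h
  rw [← dualMap_dualMap x, ← dualMap_dualMap y, h]

/-- The involution is a polynomial map over `ℚ`, hence `ℚ`-semialgebraic on the simplex. [folklore] -/
theorem isSemialgebraicMapOn_dualMap : IsSemialgebraicMapOn ℚ (simplex w) (dualMap w) := by
  have h := isSemialgebraicMapOn_aeval (KZ.isSemialgebraic_openOrderedSimplex w)
    (fun j : Fin w => (1 - X (Fin.rev j) : MvPolynomial (Fin w) ℚ))
  refine h.congr fun x _ => ?_
  funext j
  simp

/-- The integrand identity `ω_{ε†}(Φ t) = ω_ε(t)` (reindex by `rev`; `1 − (1 − a) = a`). [folklore] -/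
theorem wordFun_dualWord_dualMap (ε : Fin w → Bool) (q : ℚ) (x : Fin w → ℝ) :
    wordFun (dualWord ε) q (dualMap w x) = wordFun ε q x := by
  simp only [wordFun, dualWord, dualMap_apply]
  congr 1
  rw [← Equiv.prod_comp Fin.revPerm (fun i => if ε i then 1 / (1 - x i) else 1 / x i)]
  refine Finset.prod_congr rfl fun i _ => ?_
  simp only [Fin.revPerm_apply]
  cases ε (Fin.rev i) <;> simp

/-- **DUALITY IS ONE CHANGE-OF-VARIABLES MOVE.** [folklore] -/
theorem duality_mem_changeOfVariablesRel (ε : Fin w → Bool) (q : ℚ) (hε : Adm ε) :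
    KZ.of (wordRep ε q hε) - KZ.of (wordRep (dualWord ε) q (adm_dualWord hε)) ∈
      KZ.changeOfVariablesRel :=
  ⟨w, wordRep ε q hε, wordRep (dualWord ε) q (adm_dualWord hε), dualMap w, fun _ => dualLin w,
    isSemialgebraicMapOn_dualMap,
    fun x _ => (hasFDerivAt_dualMap x).hasFDerivWithinAt,
    injOn_dualMap,
    image_dualMap_simplex.symm,
    fun x _ => by rw [wordRep_integrand, wordRep_integrand, abs_det_dualLin, mul_one,
      wordFun_dualWord_dualMap],
    rfl⟩

/-- Duality `[Δ_w, q ω_ε] − [Δ_w, q ω_{ε†}]` is a relation (one change-of-variables move). [folklore] -/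
theorem duality_mem_relations (ε : Fin w → Bool) (q : ℚ) (hε : Adm ε) :
    KZ.of (wordRep ε q hε) - KZ.of (wordRep (dualWord ε) q (adm_dualWord hε)) ∈ KZ.relations :=
  KZ.changeOfVariablesRel_subset_relations (duality_mem_changeOfVariablesRel ε q hε)

/-- Canonical word representations of equal words are equal (proof irrelevance in `Adm`). [folklore] -/
theorem wordRep_congr {ε ε' : Fin w → Bool} (h : ε = ε') (q : ℚ) (hε : Adm ε) (hε' : Adm ε') :
    wordRep ε q hε = wordRep ε' q hε' := by
  subst h; rfl
/-- Word duality is an involution. [folklore] -/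
theorem dualWord_dualWord (ε : Fin w → Bool) : dualWord (dualWord ε) = ε := by
  funext i; simp [dualWord]

end Duality

end Summit.KontsevichZagierPeriods.MzvKernelInKZ.Negative
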